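import Literature.MathematicalPhysics.QuantumFieldTheory.Balaban1983to89.B9SupplySockB9P3ZdGammaUnivDelta2Src
import Literature.MathematicalPhysics.QuantumFieldTheory.Balaban1983to89.B8TowerBondsPrinted
import Literature.MathematicalPhysics.QuantumFieldTheory.Balaban1983to89.B8Ineq130

/-!
# BalabanUVNodes ∕ N05 ([Balaban1985RegularSpaces] Lemma 1 p. 79 – Thm 8 p. 101): THE J-N06→N05 JUNCTION'S MEMBER-LEVEL SUPPLIERS IN THE N05 ROW'S SOCKET
# CURRENCIES — dag-n06-b's edition-H ∕ δ₂ junction theorems (`sockB9P3PIδ2H_at_univ`, `sockSrc_core_at_univ_linPIδ2H`) read, at ONE `Ω₀ = ℤᵈ` member and with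
# GUARDED binders (`m ≤ k` only), into EXACTLY the three b9 socket texts `SB9P ∕ SB9srcHP ∕ SH59src` displayed by the N05 row supplier of record
# `BalabanUVNodesN05SubBP2DSlotExistsLawLanGammaPrime.exists_residB8_b8LeafOfRecordSubBP₂D_cutSubBP₅_of_lettersSrc_γ'` (p619291)

Track A of `YM-PLAN.md` (cell `pub-ymgap`, HUMAN RULING D-0062), node **N05** = [Balaban1985RegularSpaces] («B8»), in-edge **N06** = [Balaban1985BackgroundPropagators]
(«B9», print's ref. [4]); seat `pub-ymgap-dag-n05-d` (g13), 2026-08-28; bears on K1⁹ `stmt-QuantumFields-27364` (`--supports … --as helper`, count-neutral).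

WHY.  The N05 row supplier of record (p619291, «P₂D» edition) displays FIVE [4]-type hypothesis families at the (1.3)–(1.5)-admissible `Ω₀ = ℤᵈ` law members:
[4]'s letters `SLet ∕ SLetUB` (Thm 3.1) and three b9 sockets — `SB9P` (`SockB9P3H2`, Prop. 3's frame, sourceless), `SB9srcHP` (Prop. 3's frame with source, five
(1.59) lines, both-points Hölder line), `SH59src` (Thm 4's frame (1.146) with source, radius-uniform).  dag-n06-b's junction lineage (binder owner of J-N06→N05) has
LANDED member-level theorems producing these three texts from [4] Thm 3.3's blocks (3.42)–(3.47) at an abstract frame `(I, geo, bg, GA, mem, ιCfg, ιLoc, ops)` tied to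
the `ℤᵈ` objects by DICTIONARY BINDERS (`DictAt`, `Prop6At`, `InvAtH`, `CurvAtInAk`, `LandauAt`, `AvgAtP`, `HolderAtδ2`, `LinBddAt`, `SrcAt`, `SrcHolderAtδ2`):
`B9SupplySockB9P3ZdAtHerm.sockB9P3PIδ2H_at_univ` (sourceless) and `B9SupplySockB9P3ZdGammaUnivDelta2Src.sockSrc_core_at_univ_linPIδ2H` (sourced core; its family
bodies `sockB9P3srcHPIδ2H_univ_explicit_on_lin` ∕ `sockH59srcPIδ2H_univ_explicit_on_lin` were typed at this seat's g11 ask).  This file reads them into the N05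
socket currencies AT ONE MEMBER with the binders asked only at the truncations `m ≤ k` the member has (the family wrappers quantify `∀ m` unguarded), so that the
companion file `BalabanUVNodesN05SubBP2DSlotExistsOfThm33JunctionH` composes them with p619291 and N06's `B9.Thm33Printed` BY NAME.

WHAT IS PROVED (kernel, 0 sorry, 0 def; no estimate — re-packaging of landed theorems + arithmetic):
* §1 `sockB9P3H2_mono_B₀β` (the both-points socket is monotone in its Hölder constant).
* §2 ★ `sockB9P3H2_member_of_junctionH` (= `sockB9P3PIδ2H_at_univ` at truncation `k`, class `towerBondsP`, constants named by equations, Hölder constant bumped),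
  ★ `sB9srcHP_member_of_junctionH` (p619291's `SB9srcHP` body at one member from the sourced core — n06-b's family proof at one `(M, i, k)`),
  ★ `sH59src_member_of_junctionH` (p619291's `SH59src` body at one member and one radius `r` from the sourced core at every `1 ≤ m ≤ k`, `(B₈, B₀″) := (1, r)`,
  threshold `min cP (cP ∕ K₀(r))`; the socket's (1.35) ∕ `InAx` ∕ plaquette antecedents are granted but NOT used by the junction core — the N05
  socket is stronger than the supplier needs, harmlessly).
HONEST FRAMING: bookkeeping (adapted from dag-n06-b's family wrappers, cited in each docstring); 0 estimates; every junction binder is a HYPOTHESIS (N06's object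
layer — [4] Thm 3.3's operators on `ℤᵈ`, m ≥ 1 OPEN; no positive A6 witness claimed); count-neutral; **N05 NOT discharged**; Bałaban AS PRINTED; one finite 𝕋⁴
programme at fixed ε; nothing continuum ∕ ℝ⁴ ∕ OS ∕ mass-gap ∕ Clay.  No `sorry`, no new definition, no `instance`.  Unit `pub-ymgap-dag-n05-d` (g13).
[cite: Balaban1985RegularSpaces, (1.35) p.82, (1.59) p.86, Prop. 3 p.87, Thm 4 p.88, Thm 8 (1.146) p.101, (1.3)–(1.5) p.77; Balaban1985BackgroundPropagators, Thm 3.3 p.399, (3.42)–(3.47) pp.397–398, (3.26)–(3.27) p.395; Balaban1985Averaging, p.24 (locality box `Bᵏ(c₋) ∪ Bᵏ(c₊)`)]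
-/

noncomputable section

open NormedSpace

namespace Summit.QuantumFields.YangMills.BalabanUVNodes.N05JunctionHMemberSuppliers

open Literature.MathematicalPhysics.QuantumFieldTheory.Balaban1983to89
open MatrixLog B7Prop1Explicit B7Prop2Explicit B7Prop1Local B7Eq92Concrete
open B7Prop4GeneralLevels (linCovIter)
open B8Ineq130 (tlo thi)
open B8Ineq132 (covDerivFwd InAk BondTouches)
open B8Eq119TwistedAxial (Restr129 InAx)
open B8Eq184Proof (cfgExp)
open B8Lemma1NonAbelian (mulCfg)
open B8Eq140Level (SideTouches)
open B8Eq146AExpansion (iEta plaqCovDeriv)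
open B8Eq143PlaqExpansion (pdiv)
open B8Eq155JBound (Jcur wsup)
open B8ScaledSupNorm (bondNorm msup weight Bdd)
open B8Eq138LandauZd (IsLandau138 IsLandau138W IsLandau146 IsLandau146W InR138 QT covDivB logCfg covLap)
open B8LanF146 (LanF146)
open B8LeafModelZd (ZdIdx)
open B8TowerBondsPrinted (towerBondsP)
open B9Eq340HolderZd (hquot AdmPair)
open B9SupplySockB9P3ZdLetters (OpsZd)
open B9SupplySockB9P3ZdAt (DictAt Prop6At LandauAt SrcAt)
open B9SupplySockB9P3ZdAtLin (LinBddAt)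
open B9SupplySockB9P3ZdGammaUniv (AvgAtP)
open B9SupplySockB9P3ZdGammaInAk (CurvAtInAk)
open B9SupplySockB9P3ZdGammaUnivDelta2 (HolderAtδ2 SockB9P3H2)
open B9SupplySockB9P3ZdAtHerm (InvAtH sockB9P3PIδ2H_at_univ)
open B9SupplySockB9P3ZdGammaUnivDelta2Src (SrcHolderAtδ2 sockSrc_core_at_univ_linPIδ2H)
open B8Prop3GaugeFixedKLevel (mem_unitaryUnits_of_mgauge_eq)

-- `Site` alone could resolve to the torus sites of `Setup.lean`; re-export the `ℤ^d` sites of `B7Prop1Explicit`.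
export B7Prop1Explicit (Site)

variable {d : ℕ} {𝔸 : Type*} [CStarAlgebra 𝔸]

/-! ## §1 Monotonicity of the both-points socket in its Hölder constant -/

section Mono

/-- `SockB9P3H2` is monotone in the Hölder constant `B₀β` (its right-hand bracket `‖J‖₍₋₃₎ + |B₁|` is non-negative). [cite: Balaban1985RegularSpaces, (1.59) p.86, Prop. 3 p.87] -/
theorem sockB9P3H2_mono_B₀β {L : ℕ} {B₀ B₀β B₀β' cP β : ℝ} {len : Site d → ℝ} (h : B₀β ≤ B₀β') {η : ℝ} (hη : 0 ≤ η) {k : ℕ}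
    {Ω : ℕ → Set (Site d)} {Λs : ℕ → ℕ → Set (Site d)} {Λb : ℕ → ℕ → Set (Site d × Fin d)}
    (S : SockB9P3H2 (𝔸 := 𝔸) L B₀ B₀β cP β len η k Ω Λs Λb) : SockB9P3H2 (𝔸 := 𝔸) L B₀ B₀β' cP β len η k Ω Λs Λb := by
  intro α₀ α₂ hα₀ hα₀c hα₂ hα₂c U₀ W hU₀ hW hIn hIn' hLan A' hsa h41 hA0
  obtain ⟨r1, r2, r3, r4, r5⟩ := S α₀ α₂ hα₀ hα₀c hα₂ hα₂c U₀ W hU₀ hW hIn hIn' hLan A' hsa h41 hA0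
  exact ⟨r1, r2, r3, r4, r5.trans (mul_le_mul_of_nonneg_right h
    (add_nonneg (B8ScaledSupNorm.msup_nonneg L k hη _ _ _) (B8Eq155JBound.wsup_nonneg zero_le_one _)))⟩

end Mono

/-! ## §2 The three member-level suppliers in the N05 socket currencies -/

section Supply

variable [Nontrivial 𝔸]
variable {I : Type} (geo : I → B9.Geometry) (bg : I → B9.Backgrounds) (GA : ∀ i, B9.KernelFamily (geo i) (bg i))
variable (L : ℕ) (mem : ℝ → ZdIdx d L → ℕ → I)
variable (ιCfg : ∀ (M : ℝ) (i : ZdIdx d L) (m : ℕ) (U₀ : Site d → Fin d → 𝔸ˣ),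
  (∀ x κ, U₀ x κ ∈ unitaryUnits 𝔸) → (bg (mem M i m)).Cfg)
variable (ιLoc : ∀ (M : ℝ) (i : ZdIdx d L) (m : ℕ), (Site d → Fin d → 𝔸) → (geo (mem M i m)).Loc)
variable (ops : ℝ → ZdIdx d L → ℕ → OpsZd d 𝔸)

/-- ★ **`SB9P` AT ONE MEMBER FROM THE JUNCTION** — dag-n06-b's `sockB9P3PIδ2H_at_univ` at the top truncation `k`, datum class print's `towerBondsP`, the constants
NAMED by equations (`B′ = max 1 (2B₀·max 1 q)`, `cP = min …`) and the Hölder constant bumped to any `B₀βc ≥ 2·max 0 (C_H δ₀(B₀ + max 0 (Bβ β)))·max 1 q` (§1).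
[cite: Balaban1985RegularSpaces, (1.59) p.86, Prop. 3 p.87, (1.31) p.82; Balaban1985BackgroundPropagators, Thm 3.3 p.399, (3.26)–(3.27) p.395, (3.43), (3.47) p.398] -/
theorem sockB9P3H2_member_of_junctionH (hd2 : 2 ≤ d) (hL : 1 ≤ L) {c35 c₆ K₆ a₃ c69 q β : ℝ} {CH : ℝ → ℝ} {len : Site d → ℝ}
    {M₁ δ₀ a₀ B₀ : ℝ} {Bβ Bε : ℝ → ℝ} {Bεβ : ℝ → ℝ → ℝ} (hB₀ : 0 < B₀) (hδ₀ : 0 < δ₀)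
    (H : ∀ i : I, M₁ ≤ (geo i).M → ∀ α₀ : ℝ, 0 < α₀ → (geo i).M * α₀ ≤ a₀ →
      ∀ U : (bg i).Cfg, (bg i).Reg335 c35 α₀ U →
        B9.Ineq342_346_347 (GA i) B₀ δ₀ U ∧ B9.Ineq343_345 (GA i) Bβ Bε Bεβ δ₀ U)
    {M : ℝ} (hM1 : 1 ≤ M) (hMM₁ : M₁ ≤ M) (i : ZdIdx d L) (hΩ : i.Ω 0 = Set.univ)
    (hdict : DictAt geo bg GA L mem ιCfg ιLoc ops M i i.k) (hP6 : Prop6At bg L mem ιCfg c35 c₆ K₆ M i i.k)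
    (hinv : InvAtH bg L mem ιCfg ops c35 a₃ M i i.k) (hcurv : CurvAtInAk L ops c69 M i i.k)
    (hlan : LandauAt bg L mem ιCfg ops c35 a₃ M i i.k)
    (havg : AvgAtP L ops q (fun m l => towerBondsP L i.Ω (i.Λs m) l) M i i.k)
    (hhol : HolderAtδ2 geo bg GA L mem ιCfg ops β len CH M i i.k)
    (hK₆ : 0 < K₆) (hc69 : 0 ≤ c69) (hq : 0 ≤ q)
    {B' cP B₀βc : ℝ} (hB' : B' = max 1 (2 * B₀ * max 1 q))
    (hcP : cP = min (1 / 16) (min (c₆ / M) (min (a₀ / (K₆ * M)) (min (a₃ / (K₆ * M)) (1 / (2 * B₀ * c69 * M + 1))))))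
    (hB₀βc : 2 * max 0 (CH δ₀ * (B₀ + max 0 (Bβ β))) * max 1 q ≤ B₀βc) :
    SockB9P3H2 (𝔸 := 𝔸) L B' B₀βc cP β len i.η i.k i.Ω i.Λs (fun m l => towerBondsP L i.Ω (i.Λs m) l) := by
  subst hB' hcP
  refine sockB9P3H2_mono_B₀β hB₀βc i.hη.le ?_
  refine sockB9P3PIδ2H_at_univ geo bg GA L mem ιCfg ιLoc ops hd2 hL hM1 i hΩ i.k hdict hP6 hinv hcurv hlan _ havg hhol hK₆ hc69 hq
    (δ₀ := δ₀) (Bε := Bε) (Bεβ := Bεβ) hB₀ hδ₀ fun α₀ U₀ hU₀ hα₀ hMa hreg => ?_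
  have hMi : M₁ ≤ (geo (mem M i i.k)).M := by rw [hdict.1]; exact hMM₁
  have hMa' : (geo (mem M i i.k)).M * α₀ ≤ a₀ := by rw [hdict.1]; exact hMa
  exact H (mem M i i.k) hMi α₀ hα₀ hMa' (ιCfg M i i.k U₀ hU₀) hreg

/-- ★ **`SB9srcHP` AT ONE MEMBER FROM THE SOURCED JUNCTION CORE** — p619291's sourced Prop.-3-frame socket text at one `Ω₀ = ℤᵈ` member: dag-n06-b's family proof
`sockB9P3srcHPIδ2H_univ_explicit_on_lin` (adapted: one `(M, i, k)`, binders at the top truncation only, constants named by equations `B′ ∕ cP ∕ γc = 2c_Sγ₈∕B′ ∕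
γβc = (C_β c_S∕B₀ + c_Sβ)γ₈`, Hölder constant bumped to `B₀βc`). [cite: Balaban1985RegularSpaces, Prop. 3 p.87, (1.59) p.86, Thm 8 (1.146) p.101; Balaban1985BackgroundPropagators, Thm 3.3 p.399, (3.20)–(3.27) pp.394–395, (3.43), (3.47) p.398] -/
theorem sB9srcHP_member_of_junctionH (hd2 : 2 ≤ d) (hL : 1 ≤ L) {c35 c₆ K₆ a₃ c69 q β cS cSβ : ℝ} {CH : ℝ → ℝ} {len : Site d → ℝ}
    {M₁ δ₀ a₀ B₀ : ℝ} {Bβ Bε : ℝ → ℝ} {Bεβ : ℝ → ℝ → ℝ} (hB₀ : 0 < B₀) (hδ₀ : 0 < δ₀)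
    (H : ∀ i : I, M₁ ≤ (geo i).M → ∀ α₀ : ℝ, 0 < α₀ → (geo i).M * α₀ ≤ a₀ →
      ∀ U : (bg i).Cfg, (bg i).Reg335 c35 α₀ U →
        B9.Ineq342_346_347 (GA i) B₀ δ₀ U ∧ B9.Ineq343_345 (GA i) Bβ Bε Bεβ δ₀ U)
    {M : ℝ} (hM1 : 1 ≤ M) (hMM₁ : M₁ ≤ M) (i : ZdIdx d L) (hΩ : i.Ω 0 = Set.univ)
    (hdict : DictAt geo bg GA L mem ιCfg ιLoc ops M i i.k) (hP6 : Prop6At bg L mem ιCfg c35 c₆ K₆ M i i.k)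
    (hinv : InvAtH bg L mem ιCfg ops c35 a₃ M i i.k) (hcurv : CurvAtInAk L ops c69 M i i.k)
    (havg : AvgAtP L ops q (fun m l => towerBondsP L i.Ω (i.Λs m) l) M i i.k)
    (hhol : HolderAtδ2 geo bg GA L mem ιCfg ops β len CH M i i.k) (hlin : LinBddAt L ops M i i.k)
    (hsrc : SrcAt bg L mem ιCfg ops c35 a₃ cS M i i.k) (hsrcH : SrcHolderAtδ2 bg L mem ιCfg ops c35 a₃ β len cSβ M i i.k)
    (hK₆ : 0 < K₆) (hc69 : 0 ≤ c69) (hq : 0 ≤ q) (hcS : 0 ≤ cS) (hcSβ : 0 ≤ cSβ) (γ₈ : ℝ)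
    {B' cP γc γβc B₀βc : ℝ} (hB' : B' = max 1 (2 * B₀ * max 1 q))
    (hcP : cP = min (1 / 16) (min (c₆ / M) (min (a₀ / (K₆ * M)) (min (a₃ / (K₆ * M)) (1 / (2 * B₀ * c69 * M + 1))))))
    (hγc : γc = 2 * cS * γ₈ / B') (hγβc : γβc = (max 0 (CH δ₀ * (B₀ + max 0 (Bβ β))) * cS / B₀ + cSβ) * γ₈)
    (hB₀βc : 2 * max 0 (CH δ₀ * (B₀ + max 0 (Bβ β))) * max 1 q ≤ B₀βc) :
    ∀ α₀ α₁ α₂ : ℝ, 0 < α₀ → α₀ ≤ cP → 0 < α₁ → 0 < α₂ → α₂ ≤ cP →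
      ∀ (U₀ W : Site d → Fin d → 𝔸ˣ), (∀ x κ, U₀ x κ ∈ unitaryUnits 𝔸) → (∀ x κ, W x κ ∈ unitaryUnits 𝔸) →
      ∀ f : Site d → 𝔸, InR138 L i.k i.η (i.Ω 0) (i.Λs i.k) U₀ f →
      (∀ x, IsSelfAdjoint (f x)) → (∀ x, x ∉ i.Ω 0 → f x = 0) →
      Bdd L i.k i.η (-(2 : ℝ)) (fun j (x : Site d) => x ∈ i.Ω j) f →
      msup L i.k i.η (-(2 : ℝ)) (fun j (x : Site d) => x ∈ i.Ω j) f < γ₈ * (α₀ + α₁) →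
      msup L i.k i.η (-(3 : ℝ)) (fun j (p : Fin d × Site d) => p.2 ∈ i.Ω j) (fun p => covDerivFwd i.η U₀ p.1 f p.2) < γ₈ * (α₀ + α₁) →
      InAk L i.k i.η α₀ i.Ω U₀ → InAk L i.k i.η α₀ i.Ω (mulCfg W U₀) → IsLandau146W L i.k i.η (i.Ω 0) (i.Λs i.k) U₀ f W →
      ∀ A' : Site d → Fin d → 𝔸, (∀ y τ, IsSelfAdjoint (A' y τ)) →
      (∀ j, j ≤ i.k → ∀ (y : Site d) (τ : Fin d), SideTouches (i.Ω j) y τ →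
        W y τ = cfgExp i.η A' y τ ∧ ‖A' y τ‖ ≤ α₂ * ((L : ℝ) ^ j * i.η)⁻¹) →
      (∀ (y : Site d) (τ : Fin d), (∀ j, j ≤ i.k → ¬ SideTouches (i.Ω j) y τ) → A' y τ = 0) →
      msup L i.k i.η (-(1 : ℝ)) (fun j (b : Site d × Fin d) => SideTouches (i.Ω j) b.1 b.2) (fun b => A' b.1 b.2)
          ≤ B' * (bondNorm L i.k i.η (-(3 : ℝ)) i.Ω (fun x μ => Jcur i.η U₀ A' μ x)
            + wsup 1 (fun p : {p : ℕ × (Site d × Fin d) // p.1 ≤ i.k ∧ p.2 ∈ towerBondsP L i.Ω (i.Λs i.k) p.1} =>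
                linCovIter L U₀ (iEta i.η A') p.1.1 p.1.2.1 p.1.2.2)) + γc * B' * (α₀ + α₁) ∧
        msup L i.k i.η (-(2 : ℝ)) (fun j (t : Fin d × Fin d × Site d) => SideTouches (i.Ω j) t.2.2 t.2.1)
            (fun t => covDerivFwd i.η U₀ t.1 (fun z => A' z t.2.1) t.2.2)
          ≤ B' * (bondNorm L i.k i.η (-(3 : ℝ)) i.Ω (fun x μ => Jcur i.η U₀ A' μ x)
            + wsup 1 (fun p : {p : ℕ × (Site d × Fin d) // p.1 ≤ i.k ∧ p.2 ∈ towerBondsP L i.Ω (i.Λs i.k) p.1} =>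
                linCovIter L U₀ (iEta i.η A') p.1.1 p.1.2.1 p.1.2.2)) + γc * B' * (α₀ + α₁) ∧
        bondNorm L i.k i.η (-(3 : ℝ)) i.Ω (fun x μ => pdiv i.η U₀ (plaqCovDeriv i.η U₀ A') μ x)
          ≤ B' * (bondNorm L i.k i.η (-(3 : ℝ)) i.Ω (fun x μ => Jcur i.η U₀ A' μ x)
            + wsup 1 (fun p : {p : ℕ × (Site d × Fin d) // p.1 ≤ i.k ∧ p.2 ∈ towerBondsP L i.Ω (i.Λs i.k) p.1} =>
                linCovIter L U₀ (iEta i.η A') p.1.1 p.1.2.1 p.1.2.2)) + γc * B' * (α₀ + α₁) ∧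
        bondNorm L i.k i.η (-(3 : ℝ)) i.Ω (fun x μ => covLap i.η U₀ (fun z => A' z μ) x)
          ≤ B' * (bondNorm L i.k i.η (-(3 : ℝ)) i.Ω (fun x μ => Jcur i.η U₀ A' μ x)
            + wsup 1 (fun p : {p : ℕ × (Site d × Fin d) // p.1 ≤ i.k ∧ p.2 ∈ towerBondsP L i.Ω (i.Λs i.k) p.1} =>
                linCovIter L U₀ (iEta i.η A') p.1.1 p.1.2.1 p.1.2.2)) + γc * B' * (α₀ + α₁) ∧
        msup L i.k i.η (-(2 + β)) (fun j (q : Fin d × Fin d × (Site d × Site d)) => q.2.2 ∈ AdmPair i.η len ∧ q.2.2.1 ∈ i.Ω j ∧ q.2.2.2 ∈ i.Ω j)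
            (fun q => hquot i.η β len U₀ (covDerivFwd i.η U₀ q.1 (fun z => A' z q.2.1)) q.2.2)
          ≤ B₀βc * (bondNorm L i.k i.η (-(3 : ℝ)) i.Ω (fun x μ => Jcur i.η U₀ A' μ x)
            + wsup 1 (fun p : {p : ℕ × (Site d × Fin d) // p.1 ≤ i.k ∧ p.2 ∈ towerBondsP L i.Ω (i.Λs i.k) p.1} =>
                linCovIter L U₀ (iEta i.η A') p.1.1 p.1.2.1 p.1.2.2)) + γβc * (α₀ + α₁) := by
  have hM0 : 0 < M := lt_of_lt_of_le one_pos hM1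
  have hB'1 : 1 ≤ B' := by rw [hB']; exact le_max_left _ _
  have hB'0 : 0 < B' := lt_of_lt_of_le one_pos hB'1
  have hCβ0 : 0 ≤ max 0 (CH δ₀ * (B₀ + max 0 (Bβ β))) := le_max_left _ _
  intro α₀ α₁ α₂ hα₀ hα₀c hα₁ hα₂ hα₂c U₀ W hU₀ hWu f _ _ _ hfB hfF _ hInA _ hLW A' hsa h41 hA0
  have hη : 0 < i.η := i.hη
  have hα₀c' : α₀ ≤ min (1 / 16) (min (c₆ / M) (min (a₀ / (K₆ * M)) (min (a₃ / (K₆ * M)) (1 / (2 * B₀ * c69 * M + 1))))) := by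
    rw [hcP] at hα₀c; exact hα₀c
  have hα₂16 : α₂ ≤ 1 / 16 := by rw [hcP] at hα₂c; exact hα₂c.trans (min_le_left _ _)
  -- the multiplier clause for A′ = (iη)⁻¹ log W on every bond
  have hlog : ∀ (x : Site d) (μ : Fin d), BondTouches (i.Ω 0) x μ → logCfg i.η W x μ = A' x μ :=
    fun x μ _ => B9SupplySockB9P3ZdSrc.logCfg_eq_of_univ L hd2 hη hΩ U₀ hWu hα₂16 h41 x μ
  have hcl : ∃ μ : ℕ → Site d → 𝔸, ∀ x ∈ i.Ω 0,
      covLap i.η U₀ ((i.Ω 0).indicator (covDivB i.η U₀ A' - f)) x = QT L i.k (i.Λs i.k) U₀ μ x :=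
    (B9SupplySockB9P3ZdSrc.mulClause_congr f hlog).1 hLW.2
  have h33U : ∀ (α : ℝ) (V : Site d → Fin d → 𝔸ˣ) (hV : ∀ x κ, V x κ ∈ unitaryUnits 𝔸), 0 < α → M * α ≤ a₀ →
      (bg (mem M i i.k)).Reg335 c35 α (ιCfg M i i.k V hV) →
      B9.Ineq342_346_347 (GA (mem M i i.k)) B₀ δ₀ (ιCfg M i i.k V hV) ∧
        B9.Ineq343_345 (GA (mem M i i.k)) Bβ Bε Bεβ δ₀ (ιCfg M i i.k V hV) := by
    intro α V hV hα hMa hreg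
    have hMi : M₁ ≤ (geo (mem M i i.k)).M := by rw [hdict.1]; exact hMM₁
    have hMa' : (geo (mem M i i.k)).M * α ≤ a₀ := by rw [hdict.1]; exact hMa
    exact H (mem M i i.k) hMi α hα hMa' (ιCfg M i i.k V hV) hreg
  obtain ⟨r1, r2, r3, r4, r5⟩ := sockSrc_core_at_univ_linPIδ2H geo bg GA L mem ιCfg ιLoc ops hL hM1 i hΩ i.k
    hdict hP6 hinv hcurv _ havg hhol hlin hsrc hsrcH hK₆ hc69 hq hcS hcSβ hB₀ hδ₀ h33U α₀ α₂ hα₀ hα₀c' hα₂ hα₂16 U₀ hU₀ hInA A' hsa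
    (fun j hj y τ hs => (h41 j hj y τ hs).2) hA0 f hfB hcl
  rw [← hB'] at r1 r2 r3 r4
  -- the source allowance: 2c_S|f|₍₋₂₎ ≤ γc·B′·(α₀ + α₁), (C_βc_S∕B₀ + c_Sβ)|f|₍₋₂₎ ≤ γβc·(α₀ + α₁); the Hölder constant bumped
  obtain ⟨F, hF_def⟩ : ∃ F : ℝ, F = msup L i.k i.η (-(2 : ℝ)) (fun j (x : Site d) => x ∈ i.Ω j) f := ⟨_, rfl⟩
  rw [← hF_def] at r1 r2 r4 r5 hfF
  have hF0 : 0 ≤ F := by rw [hF_def]; exact B8ScaledSupNorm.msup_nonneg L _ hη.le _ _ _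
  have hS0 : 0 ≤ α₀ + α₁ := by linarith
  have hS : 2 * (cS * F) ≤ γc * B' * (α₀ + α₁) := by
    have h1 : cS * F ≤ cS * (γ₈ * (α₀ + α₁)) := mul_le_mul_of_nonneg_left hfF.le hcS
    have h2 : γc * B' * (α₀ + α₁) = 2 * (cS * (γ₈ * (α₀ + α₁))) := by rw [hγc]; field_simp
    linarith
  have hSβ : max 0 (CH δ₀ * (B₀ + max 0 (Bβ β))) * (cS * F) / B₀ + cSβ * F ≤ γβc * (α₀ + α₁) := by
    have h1 : cS * F ≤ cS * (γ₈ * (α₀ + α₁)) := mul_le_mul_of_nonneg_left hfF.le hcS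
    have h2 : max 0 (CH δ₀ * (B₀ + max 0 (Bβ β))) * (cS * F) / B₀ ≤ max 0 (CH δ₀ * (B₀ + max 0 (Bβ β))) * (cS * (γ₈ * (α₀ + α₁))) / B₀ :=
      div_le_div_of_nonneg_right (mul_le_mul_of_nonneg_left h1 hCβ0) hB₀.le
    have h3 : cSβ * F ≤ cSβ * (γ₈ * (α₀ + α₁)) := mul_le_mul_of_nonneg_left hfF.le hcSβ
    have h4 : γβc * (α₀ + α₁) =
        max 0 (CH δ₀ * (B₀ + max 0 (Bβ β))) * (cS * (γ₈ * (α₀ + α₁))) / B₀ + cSβ * (γ₈ * (α₀ + α₁)) := by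
      rw [hγβc]; field_simp
    linarith
  have hX0 : 0 ≤ bondNorm L i.k i.η (-(3 : ℝ)) i.Ω (fun x μ => Jcur i.η U₀ A' μ x)
      + wsup 1 (fun p : {p : ℕ × (Site d × Fin d) // p.1 ≤ i.k ∧ p.2 ∈ towerBondsP L i.Ω (i.Λs i.k) p.1} =>
          linCovIter L U₀ (iEta i.η A') p.1.1 p.1.2.1 p.1.2.2) :=
    add_nonneg (B8ScaledSupNorm.msup_nonneg L _ hη.le _ _ _) (B8Eq155JBound.wsup_nonneg zero_le_one _)
  have hslack : 0 ≤ γc * B' * (α₀ + α₁) := (mul_nonneg (by norm_num) (mul_nonneg hcS hF0)).trans hS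
  exact ⟨r1.trans (by linarith), r2.trans (by linarith), r3.trans (le_add_of_nonneg_right hslack), r4.trans (by linarith),
    r5.trans (add_le_add (mul_le_mul_of_nonneg_right hB₀βc hX0) hSβ)⟩

/-- ★ **`SH59src` AT ONE MEMBER AND ONE RADIUS FROM THE SOURCED JUNCTION CORE** — p619291's Thm-4-frame sourced socket text (radius `r`, γ′ letter, the
ONE-END-POINT (1.35) antecedent) at one `Ω₀ = ℤᵈ` member: dag-n06-b's family proof `sockH59srcPIδ2H_univ_explicit_on_lin` (adapted: one `(M, i)`, every truncation
`1 ≤ m ≤ k` from the member-level core with binders guarded `m ≤ k`, `(B₈, B₀″) := (1, r)`, threshold `min cP (cP ∕ K₀)` with `K₀ = 2(L·5dL) + 8(8r·5dL)`, constants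
named by equations; the socket's extra (1.35) ∕ `InAx` ∕ plaquette antecedents are dropped, as in n06-b's family proof). [cite: Balaban1985RegularSpaces, Thm 4 p.88, Thm 8 (1.146) p.101, (1.59) p.86, (1.35) p.82; Balaban1985BackgroundPropagators, Thm 3.3 p.399, (3.20)–(3.27) pp.394–395, (3.47) p.398] -/
theorem sH59src_member_of_junctionH (hd2 : 2 ≤ d) (hL : 1 ≤ L) {c35 c₆ K₆ a₃ c69 q β cS cSβ : ℝ} {CH : ℝ → ℝ} {len : Site d → ℝ}
    {M₁ δ₀ a₀ B₀ : ℝ} {Bβ Bε : ℝ → ℝ} {Bεβ : ℝ → ℝ → ℝ} (hB₀ : 0 < B₀) (hδ₀ : 0 < δ₀)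
    (H : ∀ i : I, M₁ ≤ (geo i).M → ∀ α₀ : ℝ, 0 < α₀ → (geo i).M * α₀ ≤ a₀ →
      ∀ U : (bg i).Cfg, (bg i).Reg335 c35 α₀ U →
        B9.Ineq342_346_347 (GA i) B₀ δ₀ U ∧ B9.Ineq343_345 (GA i) Bβ Bε Bεβ δ₀ U)
    {M : ℝ} (hM1 : 1 ≤ M) (hMM₁ : M₁ ≤ M) (i : ZdIdx d L) (hΩ : i.Ω 0 = Set.univ)
    (hdict : ∀ m, m ≤ i.k → DictAt geo bg GA L mem ιCfg ιLoc ops M i m) (hP6 : ∀ m, m ≤ i.k → Prop6At bg L mem ιCfg c35 c₆ K₆ M i m)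
    (hinv : ∀ m, m ≤ i.k → InvAtH bg L mem ιCfg ops c35 a₃ M i m) (hcurv : ∀ m, m ≤ i.k → CurvAtInAk L ops c69 M i m)
    (havg : ∀ m, m ≤ i.k → AvgAtP L ops q (fun m l => towerBondsP L i.Ω (i.Λs m) l) M i m)
    (hhol : ∀ m, m ≤ i.k → HolderAtδ2 geo bg GA L mem ιCfg ops β len CH M i m) (hlin : ∀ m, m ≤ i.k → LinBddAt L ops M i m)
    (hsrc : ∀ m, m ≤ i.k → SrcAt bg L mem ιCfg ops c35 a₃ cS M i m)
    (hsrcH : ∀ m, m ≤ i.k → SrcHolderAtδ2 bg L mem ιCfg ops c35 a₃ β len cSβ M i m)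
    (hK₆ : 0 < K₆) (hc69 : 0 ≤ c69) (hq : 0 ≤ q) (hcS : 0 ≤ cS) (hcSβ : 0 ≤ cSβ) (γ₈ : ℝ)
    {B' cP γc : ℝ} (hB' : B' = max 1 (2 * B₀ * max 1 q))
    (hcP : cP = min (1 / 16) (min (c₆ / M) (min (a₀ / (K₆ * M)) (min (a₃ / (K₆ * M)) (1 / (2 * B₀ * c69 * M + 1))))))
    (hγc : γc = 2 * cS * γ₈ / B') (r : ℝ) (hr : 0 ≤ r) :
    ∀ α₀ α₁ : ℝ, 0 < α₀ → 0 < α₁ →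
      α₀ + α₁ ≤ min cP (cP / (2 * (L * (5 * (d : ℝ) * L * 1)) + 8 * (8 * r * (5 * (d : ℝ) * L * 1)))) →
      ∀ U₀ U' : Site d → Fin d → 𝔸ˣ, (∀ x κ, U₀ x κ ∈ unitaryUnits 𝔸) → (∀ x κ, U' x κ ∈ unitaryUnits 𝔸) →
      ∀ φ : Site d → 𝔸, ((InR138 L i.k i.η (i.Ω 0) (i.Λs i.k) U₀ φ ∧ (∀ x, IsSelfAdjoint (φ x)) ∧ (∀ x, x ∉ i.Ω 0 → φ x = 0) ∧
          Bdd L i.k i.η (-(2 : ℝ)) (fun j (x : Site d) => x ∈ i.Ω j) φ) ∧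
        msup L i.k i.η (-(2 : ℝ)) (fun j (x : Site d) => x ∈ i.Ω j) φ < γ₈ * (α₀ + α₁)) →
      InAk L i.k i.η α₀ i.Ω U₀ → InAk L i.k i.η α₀ i.Ω (mulCfg U' U₀) → (∀ m, m ≤ i.k → InAx L m (i.Λs m) U₀ (mulCfg U' U₀)) →
      (∀ j, j ≤ i.k → ∀ (z : Site d) (μ : Fin d),
        ((∀ x, InBox (tlo L z j) (thi L z j) x → x ∈ i.Ω j) ∨ (∀ x, InBox (tlo L (z + e μ) j) (thi L (z + e μ) j) x → x ∈ i.Ω j)) →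
        ‖(avgIter L (mulCfg U' U₀) j z μ : 𝔸) - (avgIter L U₀ j z μ : 𝔸)‖ ≤ α₁) →
      (∀ b ∈ {b : Site d × Fin d | SideTouches (i.Ω 0) b.1 b.2}, ‖((U' b.1 b.2 : 𝔸ˣ) : 𝔸) - 1‖ ≤ α₁) →
      (∀ m, 1 ≤ m → m ≤ i.k → ∀ (u : Site d → 𝔸ˣ) (W : Site d → Fin d → 𝔸ˣ) (A' : Site d → Fin d → 𝔸),
        (∀ x, u x ∈ unitaryUnits 𝔸) → mgauge U₀ u W = U' → Restr129 L m (i.Λs m) U₀ u → LanF146 L i.k i.η (i.Ω 0) i.Λs U₀ φ m W →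
        (∀ y τ, IsSelfAdjoint (A' y τ)) →
        (∀ j, j ≤ m → ∀ y τ, SideTouches (i.Ω j) y τ →
        W y τ = cfgExp i.η A' y τ ∧ ‖A' y τ‖ ≤ r * (α₀ + α₁) * ((L : ℝ) ^ j * i.η)⁻¹) →
        (∀ y τ, (∀ j, j ≤ m → ¬ SideTouches (i.Ω j) y τ) → A' y τ = 0) →
        msup L m i.η (-(1 : ℝ)) (fun j (b : Site d × Fin d) => SideTouches (i.Ω j) b.1 b.2) (fun b => A' b.1 b.2)
        ≤ B' * (bondNorm L m i.η (-(3 : ℝ)) i.Ω (fun x μ => Jcur i.η U₀ A' μ x)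
        + wsup 1 (fun p : {p : ℕ × (Site d × Fin d) // p.1 ≤ m ∧ p.2 ∈ towerBondsP L i.Ω (i.Λs m) p.1} =>
        linCovIter L U₀ (iEta i.η A') p.1.1 p.1.2.1 p.1.2.2)) + γc * B' * (α₀ + α₁) ∧
        msup L m i.η (-(2 : ℝ)) (fun j (t : Fin d × Fin d × Site d) => SideTouches (i.Ω j) t.2.2 t.2.1)
        (fun t => covDerivFwd i.η U₀ t.1 (fun z => A' z t.2.1) t.2.2)
        ≤ B' * (bondNorm L m i.η (-(3 : ℝ)) i.Ω (fun x μ => Jcur i.η U₀ A' μ x)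
        + wsup 1 (fun p : {p : ℕ × (Site d × Fin d) // p.1 ≤ m ∧ p.2 ∈ towerBondsP L i.Ω (i.Λs m) p.1} =>
        linCovIter L U₀ (iEta i.η A') p.1.1 p.1.2.1 p.1.2.2)) + γc * B' * (α₀ + α₁)) := by
  have hM0 : 0 < M := lt_of_lt_of_le one_pos hM1
  have hL' : (1 : ℝ) ≤ L := by exact_mod_cast hL
  have hd' : (1 : ℝ) ≤ d := by exact_mod_cast (le_trans (by norm_num) hd2 : 1 ≤ d)
  have hB'1 : 1 ≤ B' := by rw [hB']; exact le_max_left _ _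
  have hB'0 : 0 < B' := lt_of_lt_of_le one_pos hB'1
  set K₀ : ℝ := (2 * (L * (5 * (d : ℝ) * L * 1)) + 8 * (8 * r * (5 * (d : ℝ) * L * 1))) with hK₀_def
  have hK₀r : r ≤ K₀ := by
    have hdL : (1 : ℝ) ≤ (d : ℝ) * L := by nlinarith [hd', hL']
    have h1 : 0 ≤ 2 * (L * (5 * (d : ℝ) * L * 1)) := by positivity
    have h2 : r ≤ 8 * (8 * r * (5 * (d : ℝ) * L * 1)) := by nlinarith [mul_le_mul_of_nonneg_left hdL hr, hr]
    rw [hK₀_def]; linarith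
  have hK₀ : 0 < K₀ := by
    have h1 : 0 < 2 * (L * (5 * (d : ℝ) * L * 1)) := by positivity
    have h2 : 0 ≤ 8 * (8 * r * (5 * (d : ℝ) * L * 1)) := by positivity
    linarith
  intro α₀ α₁ hα₀ hα₁ hs U₀ U' hU₀ hU' φ hφ hInA _ _ _ _ m _ hmk u W A' hu hW _ hLanF hsa h41 hA0
  obtain ⟨⟨-, -, -, hφB⟩, hφF⟩ := hφ
  have hη : 0 < i.η := i.hη
  -- the smallness constant of the datum and the guard of the level-`m` socket
  set K : ℝ := K₀ * (α₀ + α₁) with hK_def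
  have hS0 : 0 < α₀ + α₁ := add_pos hα₀ hα₁
  have hKpos : 0 < K := mul_pos hK₀ hS0
  have hα₀P : α₀ ≤ cP := by linarith only [hα₁, hs, min_le_left cP (cP / K₀)]
  have hKP : K ≤ cP := by
    have h1 : α₀ + α₁ ≤ cP / K₀ := hs.trans (min_le_right _ _)
    calc K = K₀ * (α₀ + α₁) := hK_def
      _ ≤ K₀ * (cP / K₀) := mul_le_mul_of_nonneg_left h1 hK₀.le
      _ = cP := by field_simp
  have hK16 : K ≤ 1 / 16 := hKP.trans (by rw [hcP]; exact min_le_left _ _)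
  have hα₀P' : α₀ ≤ min (1 / 16) (min (c₆ / M) (min (a₀ / (K₆ * M)) (min (a₃ / (K₆ * M)) (1 / (2 * B₀ * c69 * M + 1))))) := by
    rw [hcP] at hα₀P; exact hα₀P
  -- the radius letter: r(α₀ + α₁) ≤ K
  have hrK : r * (α₀ + α₁) ≤ K := by rw [hK_def]; exact mul_le_mul_of_nonneg_right hK₀r hS0.le
  have h41K : ∀ j, j ≤ m → ∀ (y : Site d) (τ : Fin d), SideTouches (i.Ω j) y τ →
      W y τ = cfgExp i.η A' y τ ∧ ‖A' y τ‖ ≤ K * ((L : ℝ) ^ j * i.η)⁻¹ := fun j hj y τ hs' =>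
    ⟨(h41 j hj y τ hs').1, (h41 j hj y τ hs').2.trans
      (mul_le_mul_of_nonneg_right hrK (inv_nonneg.mpr (B8ScaledSupNorm.scale_pos hL hη j).le))⟩
  -- the datum is a datum of the sourced core at level `m`
  have hWu : ∀ x κ, W x κ ∈ unitaryUnits 𝔸 := mem_unitaryUnits_of_mgauge_eq hU₀ hU' hu hW
  have hInAm : InAk L m i.η α₀ i.Ω U₀ := fun j hj => hInA j (hj.trans hmk)
  have hlog : ∀ (x : Site d) (μ : Fin d), BondTouches (i.Ω 0) x μ → logCfg i.η W x μ = A' x μ :=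
    fun x μ _ => B9SupplySockB9P3ZdSrc.logCfg_eq_of_univ L hd2 hη hΩ U₀ hWu hK16 h41K x μ
  have hcl : ∃ μ : ℕ → Site d → 𝔸, ∀ x ∈ i.Ω 0,
      covLap i.η U₀ ((i.Ω 0).indicator (covDivB i.η U₀ A' - φ)) x = QT L m (i.Λs m) U₀ μ x :=
    (B9SupplySockB9P3ZdSrc.mulClause_congr φ hlog).1 hLanF.1
  have h33U : ∀ (α : ℝ) (V : Site d → Fin d → 𝔸ˣ) (hV : ∀ x κ, V x κ ∈ unitaryUnits 𝔸), 0 < α → M * α ≤ a₀ →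
      (bg (mem M i m)).Reg335 c35 α (ιCfg M i m V hV) →
      B9.Ineq342_346_347 (GA (mem M i m)) B₀ δ₀ (ιCfg M i m V hV) ∧
        B9.Ineq343_345 (GA (mem M i m)) Bβ Bε Bεβ δ₀ (ιCfg M i m V hV) := by
    intro α V hV hα hMa hreg
    have hMi : M₁ ≤ (geo (mem M i m)).M := by rw [(hdict m hmk).1]; exact hMM₁
    have hMa' : (geo (mem M i m)).M * α ≤ a₀ := by rw [(hdict m hmk).1]; exact hMa
    exact H (mem M i m) hMi α hα hMa' (ιCfg M i m V hV) hreg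
  obtain ⟨r1, r2, -, -, -⟩ := sockSrc_core_at_univ_linPIδ2H geo bg GA L mem ιCfg ιLoc ops hL hM1 i hΩ m
    (hdict m hmk) (hP6 m hmk) (hinv m hmk) (hcurv m hmk) _ (havg m hmk) (hhol m hmk) (hlin m hmk)
    (hsrc m hmk) (hsrcH m hmk) hK₆ hc69 hq hcS hcSβ hB₀ hδ₀ h33U α₀ K hα₀ hα₀P' hKpos hK16 U₀ hU₀ hInAm A' hsa
    (fun j hj y τ hs' => (h41K j hj y τ hs').2) hA0 φ hφB hcl
  rw [← hB'] at r1 r2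
  obtain ⟨F, hF_def⟩ : ∃ F : ℝ, F = msup L i.k i.η (-(2 : ℝ)) (fun j (x : Site d) => x ∈ i.Ω j) φ := ⟨_, rfl⟩
  rw [← hF_def] at r1 r2 hφF
  have hS : 2 * (cS * F) ≤ γc * B' * (α₀ + α₁) := by
    have h1 : cS * F ≤ cS * (γ₈ * (α₀ + α₁)) := mul_le_mul_of_nonneg_left hφF.le hcS
    have h2 : γc * B' * (α₀ + α₁) = 2 * (cS * (γ₈ * (α₀ + α₁))) := by rw [hγc]; field_simp
    linarith
  exact ⟨r1.trans (by linarith), r2.trans (by linarith)⟩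

end Supply

end Summit.QuantumFields.YangMills.BalabanUVNodes.N05JunctionHMemberSuppliers

end
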